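/-
Copyright (c) 2026. All rights reserved.
Released under Apache 2.0 license as described in the file LICENSE.
-/
import Summits.HodgeConjecture.HodgeConjecture.Theorems.K2LiuSiegelEisensteinArchClassTransport   -- ★ (T) END `continuation_of_archReference` (+ ★ glue, ★ (T4), ★ (T3-arch), ★ `isStd_of_conj`)
import HarnessLib

/-!
# Crux `HLiu418`, socket #41, ORGAN (T′): THE (R-c) TRANSPORT WITH THE POLE SET PINNED — `continuation_transport_poleSet`, `continuation_of_conjDatum_poleSet`,
# `continuation_of_archReference_poleSet` (RULING M-158w (2), LEAD F0P6-plan (g14); desk K2Liu-p25 (g2) recipe 23:31:21Z)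

Cell `hodgecm-mathlib`, crux item hLiu418 = `stmt-HodgeConjecture-24832` (helper lane `--supports`, count-neutral; closes no socket).  K2Liu-p11 (g4).
★ `K2LiuSiegelEisensteinRightTranslation.continuation_transport` ∕ ★ `…ConjugateDatumTransport.continuation_of_conjDatum` ∕ ★ `…ArchClassTransport.continuation_of_archReference`
conclude `∃ P Es, (A1)–(A5)` although the bottom proof KEEPS the pole-clearing finset `P` (`refine ⟨P, …⟩`); the (Q-P) payers of FACE-A's (PIN)∕(PIN′) (★ ED.19∕20-poleSet,
K2E3-typ2 (g2) finding (T-P) 23:31:59Z, K2Liu-ref1 (δ)(ii)) need the transport AT A FIXED `P`.  THIS FILE = the three heads re-concluded with `P` BY VALUE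
(`P` quantified BEFORE the socket hypothesis so the consumer's pinned `hpin` instantiates at its own `P`); proofs = the ★ proofs verbatim minus the `∃ P` packing.
* §1 **`continuation_transport_poleSet`** (T′-4); §2 **`continuation_of_conjDatum_poleSet`** (T′-glue); §3 **`continuation_of_archReference_poleSet`** (T′-END).
References: [MoeglinWaldspurger1995, II.1.5, IV.1.8]; [BorelJacquet1979, §1.2, §4.1]; [Weil1964, Chap. I n° 8]; [Tan1999, §1].
HONEST LABEL: HC_CM is proved only modulo the 7 printed citations (2 remaining named inputs: hLiu418 = stmt-HodgeConjecture-24832,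
h413 = stmt-HodgeConjecture-24833) until rung 0 closes; count-neutral helper, closes no socket.
-/

set_option autoImplicit false
set_option linter.dupNamespace false

noncomputable section

open scoped Matrix Topology
open NumberField IsDedekindDomain Filter Set Metric
open Literature.NumberTheory.Automorphic Literature.NumberTheory.Automorphic.UnitaryGroup Literature.NumberTheory.GaloisRepresentations
open Literature.NumberTheory.GelbartRogawski1991 Literature.NumberTheory.GelbartRogawski1991.GRConstruction
open Literature.NumberTheory.K2Lit.SiegelDoubled

namespace Summit.HodgeConjecture.HodgeConjecture.Cruxes.HLiu418.K2LiuSiegelEisensteinArchClassTransportPoleSet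

open Summit.HodgeConjecture.HodgeConjecture.Cruxes.HLiu418.K2LiuRankOneCentreContinuation (differentiable_siegelDeltaCharacter)
open Summit.HodgeConjecture.HodgeConjecture.Cruxes.HLiu418.K2LiuSiegelEisensteinRightTranslation
open Summit.HodgeConjecture.HodgeConjecture.Cruxes.HLiu418.K2LiuSiegelEisensteinConjugateDatumTransport (siegelDelta_conj_of_conj)
open Summit.HodgeConjecture.HodgeConjecture.Cruxes.HLiu418.K2LiuIwasawaDatumConjStd (isStd_of_conj)
open Summit.HodgeConjecture.HodgeConjecture.Cruxes.HLiu418.K2LiuArchMajorantTransitivity (exists_isSiegelDelta_conjDatum_arch_iff)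

variable (L : Type) [Field L] [NumberField L] [IsCMField L]
variable {N M n : ℕ} (e : Fin N × Fin M ≃ Fin n)
  (dV : Fin N → L) (hdV : ∀ i, IsCMField.complexConj L (dV i) = dV i) (hdV0 : ∀ i, dV i ≠ 0)
  (dW : Fin M → L) (hdW : ∀ i, IsCMField.complexConj L (dW i) = dW i) (hdW0 : ∀ i, dW i ≠ 0)

/-! ## §1 (T′-4) -/

/-- **(T′-4) PINNED TRANSPORT OF THE CONTINUATION** — ★ `continuation_transport` with the pole set `P` CARRIED THROUGH (its proof already keeps `P`; only the
`∃ P′` packing is dropped): `Es′(s, h) := χ_s(p) · Es(s, h·p⁻¹)` satisfies (A1)–(A5) for `f′` AT THE SAME `P`.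
[cite: MoeglinWaldspurger1995, II.1.5, IV.1.8] [cite: BorelJacquet1979, §1.2] [cite: Tan1999, §1] -/
theorem continuation_transport_poleSet (hn : 0 < n) {χ : HeckeCharacter L} (p : HA L e dV hdV dW hdW)
    (f' : ℂ → HA L e dV hdV dW hdW → ℂ) (P : Finset ℂ) (Es : ℂ → HA L e dV hdV dW hdW → ℂ)
    (hA1 : ∀ h : HA L e dV hdV dW hdW, DifferentiableOn ℂ (fun s => Es s h) {s : ℂ | 0 < s.re})
    (hA2 : ∀ s : ℂ, 0 < s.re → Continuous (Es s))
    (hA3 : ∀ s : ℂ, 0 < s.re → ∀ (γ : ratH L e dV hdV dW hdW) (h : HA L e dV hdV dW hdW), Es s ((γ : HA L e dV hdV dW hdW) * h) = Es s h)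
    (hA4 : ∀ (s : ℂ) (h : HA L e dV hdV dW hdW), (n : ℝ) / 2 < s.re →
      Es s h = (∏ q ∈ P, (s - q)) * eisensteinFamilyDelta L e dV hdV dW hdW (fun s h => (siegelDeltaCharacter L e dV hdV dW hdW χ s p)⁻¹ * f' s (h * p)) s h)
    (hA5 : ∀ z : ℂ, 0 < z.re → ∃ C A r : ℝ, 0 < r ∧ ∀ s : ℂ, dist s z < r → ∀ h : HA L e dV hdV dW hdW,
      ‖Es s h‖ ≤ C * adelicHeightGL (n + n) L (h : GL (Fin (n + n)) (AdeleRing (𝓞 L) L)) ^ A) :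
    ∃ Es' : ℂ → HA L e dV hdV dW hdW → ℂ,
      (∀ h : HA L e dV hdV dW hdW, DifferentiableOn ℂ (fun s => Es' s h) {s : ℂ | 0 < s.re}) ∧
      (∀ s : ℂ, 0 < s.re → Continuous (Es' s)) ∧
      (∀ s : ℂ, 0 < s.re → ∀ (γ : ratH L e dV hdV dW hdW) (h : HA L e dV hdV dW hdW), Es' s ((γ : HA L e dV hdV dW hdW) * h) = Es' s h) ∧
      (∀ (s : ℂ) (h : HA L e dV hdV dW hdW), (n : ℝ) / 2 < s.re →
        Es' s h = (∏ q ∈ P, (s - q)) * eisensteinFamilyDelta L e dV hdV dW hdW f' s h) ∧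
      (∀ z : ℂ, 0 < z.re → ∃ C A r : ℝ, 0 < r ∧ ∀ s : ℂ, dist s z < r → ∀ h : HA L e dV hdV dW hdW,
        ‖Es' s h‖ ≤ C * adelicHeightGL (n + n) L (h : GL (Fin (n + n)) (AdeleRing (𝓞 L) L)) ^ A) := by
  haveI : NeZero (n + n) := ⟨by omega⟩
  refine ⟨fun s h => siegelDeltaCharacter L e dV hdV dW hdW χ s p * Es s (h * p⁻¹), fun h => ?_, fun s hs => ?_, fun s hs γ h => ?_, fun s h hs => ?_,
    fun z hz => ?_⟩
  · -- (A1)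
    exact (differentiable_siegelDeltaCharacter L e dV hdV dW hdW χ p).differentiableOn.mul (hA1 (h * p⁻¹))
  · -- (A2)
    exact continuous_const.mul ((hA2 s hs).comp (continuous_id.mul continuous_const))
  · -- (A3)
    show siegelDeltaCharacter L e dV hdV dW hdW χ s p * Es s ((γ : HA L e dV hdV dW hdW) * h * p⁻¹) =
      siegelDeltaCharacter L e dV hdV dW hdW χ s p * Es s (h * p⁻¹)
    rw [mul_assoc (γ : HA L e dV hdV dW hdW) h p⁻¹, hA3 s hs γ (h * p⁻¹)]
  · -- (A4): by (T1)
    show siegelDeltaCharacter L e dV hdV dW hdW χ s p * Es s (h * p⁻¹) = (∏ q ∈ P, (s - q)) * eisensteinFamilyDelta L e dV hdV dW hdW f' s h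
    rw [hA4 s (h * p⁻¹) hs, eisensteinFamilyDelta_normalisedTranslate, inv_mul_cancel_right, mul_left_comm,
      mul_inv_cancel_left₀ (siegelDeltaCharacter_ne_zero L e dV hdV dW hdW χ s p)]
  · -- (A5): two-sided height comparison + a bound of `|χ_s(p)|` on the ball
    obtain ⟨C, A, r, hr, hCA⟩ := hA5 z hz
    obtain ⟨B, hB0, hB⟩ := exists_bound_siegelDeltaCharacter L e dV hdV dW hdW χ p z r
    obtain ⟨c, hc0, hc⟩ := exists_rpow_adelicHeightGL_mul_right_le L ((p⁻¹ : HA L e dV hdV dW hdW) : GL (Fin (n + n)) (AdeleRing (𝓞 L) L)) A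
    have hC0 : 0 ≤ C := by
      have h1 := hCA z (by rwa [dist_self]) 1
      have hpos : 0 < adelicHeightGL (n + n) L ((1 : HA L e dV hdV dW hdW) : GL (Fin (n + n)) (AdeleRing (𝓞 L) L)) ^ A :=
        Real.rpow_pos_of_pos (adelicHeightGL_pos_holds (n := n + n) (K := L) _) A
      nlinarith [norm_nonneg (Es z 1)]
    refine ⟨B * C * c, A, r, hr, fun s hs h => ?_⟩
    have hh := hCA s hs (h * p⁻¹)
    have hpow := hc (h : GL (Fin (n + n)) (AdeleRing (𝓞 L) L))
    rw [norm_mul]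
    have hcoe : ((h * p⁻¹ : HA L e dV hdV dW hdW) : GL (Fin (n + n)) (AdeleRing (𝓞 L) L)) =
        (h : GL (Fin (n + n)) (AdeleRing (𝓞 L) L)) * ((p⁻¹ : HA L e dV hdV dW hdW) : GL (Fin (n + n)) (AdeleRing (𝓞 L) L)) := rfl
    rw [hcoe] at hh
    calc ‖siegelDeltaCharacter L e dV hdV dW hdW χ s p‖ * ‖Es s (h * p⁻¹)‖
        ≤ B * (C * (c * adelicHeightGL (n + n) L (h : GL (Fin (n + n)) (AdeleRing (𝓞 L) L)) ^ A)) :=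
          mul_le_mul (hB s hs) (hh.trans (mul_le_mul_of_nonneg_left hpow hC0)) (norm_nonneg _) hB0
      _ = B * C * c * adelicHeightGL (n + n) L (h : GL (Fin (n + n)) (AdeleRing (𝓞 L) L)) ^ A := by ring

/-! ## §2 (T′-glue) -/

/-- **(T′-glue) PINNED CONJUGATE-DATUM TRANSPORT** — ★ `continuation_of_conjDatum` with the pole set `P` quantified BEFORE the socket hypothesis and carried
through: socket #41's five clauses AT `P` for the standard continuous families of `(𝒦₀, χ)` give them AT THE SAME `P` for those of the conjugate datum `𝒦`.
[cite: MoeglinWaldspurger1995, II.1.5, IV.1.8] [cite: BorelJacquet1979, §4.1] [cite: Tan1999, §1] -/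
theorem continuation_of_conjDatum_poleSet (hn : 0 < n) {χ : HeckeCharacter L} (𝒦₀ 𝒦 : IwasawaDatum L e dV hdV dW hdW) (c : HA L e dV hdV dW hdW)
    (hc : ∀ k : HA L e dV hdV dW hdW, k ∈ 𝒦₀.K ↔ c * k * c⁻¹ ∈ 𝒦.K) (P : Finset ℂ)
    (h41 : ∀ f : ℂ → HA L e dV hdV dW hdW → ℂ, IsStandardSectionFamily 𝒦₀ χ f → (∀ s, Continuous (f s)) →
      ∃ Es : ℂ → HA L e dV hdV dW hdW → ℂ,
        (∀ h : HA L e dV hdV dW hdW, DifferentiableOn ℂ (fun s => Es s h) {s : ℂ | 0 < s.re}) ∧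
        (∀ s : ℂ, 0 < s.re → Continuous (Es s)) ∧
        (∀ s : ℂ, 0 < s.re → ∀ (γ : ratH L e dV hdV dW hdW) (h : HA L e dV hdV dW hdW), Es s ((γ : HA L e dV hdV dW hdW) * h) = Es s h) ∧
        (∀ (s : ℂ) (h : HA L e dV hdV dW hdW), (n : ℝ) / 2 < s.re →
          Es s h = (∏ q ∈ P, (s - q)) * eisensteinFamilyDelta L e dV hdV dW hdW f s h) ∧
        (∀ z : ℂ, 0 < z.re → ∃ C A r : ℝ, 0 < r ∧ ∀ s : ℂ, dist s z < r → ∀ h : HA L e dV hdV dW hdW,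
          ‖Es s h‖ ≤ C * adelicHeightGL (n + n) L (h : GL (Fin (n + n)) (AdeleRing (𝓞 L) L)) ^ A))
    (f' : ℂ → HA L e dV hdV dW hdW → ℂ) (hstd' : IsStandardSectionFamily 𝒦 χ f') (hcont' : ∀ s, Continuous (f' s)) :
    ∃ Es : ℂ → HA L e dV hdV dW hdW → ℂ,
      (∀ h : HA L e dV hdV dW hdW, DifferentiableOn ℂ (fun s => Es s h) {s : ℂ | 0 < s.re}) ∧
      (∀ s : ℂ, 0 < s.re → Continuous (Es s)) ∧
      (∀ s : ℂ, 0 < s.re → ∀ (γ : ratH L e dV hdV dW hdW) (h : HA L e dV hdV dW hdW), Es s ((γ : HA L e dV hdV dW hdW) * h) = Es s h) ∧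
      (∀ (s : ℂ) (h : HA L e dV hdV dW hdW), (n : ℝ) / 2 < s.re →
        Es s h = (∏ q ∈ P, (s - q)) * eisensteinFamilyDelta L e dV hdV dW hdW f' s h) ∧
      (∀ z : ℂ, 0 < z.re → ∃ C A r : ℝ, 0 < r ∧ ∀ s : ℂ, dist s z < r → ∀ h : HA L e dV hdV dW hdW,
        ‖Es s h‖ ≤ C * adelicHeightGL (n + n) L (h : GL (Fin (n + n)) (AdeleRing (𝓞 L) L)) ^ A) := by
  obtain ⟨q, hq, hKK'⟩ := siegelDelta_conj_of_conj L e dV hdV dW hdW 𝒦₀ 𝒦 c hc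
  obtain ⟨Es, hA1, hA2, hA3, hA4, hA5⟩ := h41 _ (isStandardSectionFamily_normalisedTranslate 𝒦₀ 𝒦 hq hKK' hstd')
    (continuous_normalisedTranslate hcont' (fun s => siegelDeltaCharacter L e dV hdV dW hdW χ s q) q)
  exact continuation_transport_poleSet L e dV hdV dW hdW hn q f' P Es hA1 hA2 hA3 hA4 hA5

/-! ## §3 (T′-END) -/

include hdV0 hdW0 in
/-- **(T′-END) PINNED ARCHIMEDEAN-CLASS TRANSPORT** — ★ `continuation_of_archReference` with the pole set `P` carried through: socket #41 AT `P` on the archimedean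
class of a standard reference datum `𝒦₁` gives socket #41 AT THE SAME `P` for every standard continuous family of every standard `𝒦₂` (the (Q-P) payer of
(PIN)∕(PIN′) at an ARBITRARY standard datum). [cite: MoeglinWaldspurger1995, II.1.5, IV.1.8] [cite: BorelJacquet1979, §4.1] [cite: Weil1964, Chap. I n° 8] [cite: Tan1999, §1] -/
theorem continuation_of_archReference_poleSet (hn : 0 < n) {χ : HeckeCharacter L} {𝒦₁ : IwasawaDatum L e dV hdV dW hdW} (h₁ : 𝒦₁.IsStd) (P : Finset ℂ)
    (h41 : ∀ 𝒦 : IwasawaDatum L e dV hdV dW hdW, 𝒦.IsStd →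
      (∀ a : arch (Fp L) L (IsCMField.complexConj L) (n + n) (hermD L e dV hdV dW hdW),
        (archToAdelic (Fp L) L (IsCMField.complexConj L) (n + n) (hermD L e dV hdV dW hdW) a : HA L e dV hdV dW hdW) ∈ 𝒦.K ↔
          (archToAdelic (Fp L) L (IsCMField.complexConj L) (n + n) (hermD L e dV hdV dW hdW) a : HA L e dV hdV dW hdW) ∈ 𝒦₁.K) →
      ∀ f : ℂ → HA L e dV hdV dW hdW → ℂ, IsStandardSectionFamily 𝒦 χ f → (∀ s, Continuous (f s)) →
      ∃ Es : ℂ → HA L e dV hdV dW hdW → ℂ,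
        (∀ h : HA L e dV hdV dW hdW, DifferentiableOn ℂ (fun s => Es s h) {s : ℂ | 0 < s.re}) ∧
        (∀ s : ℂ, 0 < s.re → Continuous (Es s)) ∧
        (∀ s : ℂ, 0 < s.re → ∀ (γ : ratH L e dV hdV dW hdW) (h : HA L e dV hdV dW hdW), Es s ((γ : HA L e dV hdV dW hdW) * h) = Es s h) ∧
        (∀ (s : ℂ) (h : HA L e dV hdV dW hdW), (n : ℝ) / 2 < s.re →
          Es s h = (∏ q ∈ P, (s - q)) * eisensteinFamilyDelta L e dV hdV dW hdW f s h) ∧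
        (∀ z : ℂ, 0 < z.re → ∃ C A r : ℝ, 0 < r ∧ ∀ s : ℂ, dist s z < r → ∀ h : HA L e dV hdV dW hdW,
          ‖Es s h‖ ≤ C * adelicHeightGL (n + n) L (h : GL (Fin (n + n)) (AdeleRing (𝓞 L) L)) ^ A))
    {𝒦₂ : IwasawaDatum L e dV hdV dW hdW} (h₂ : 𝒦₂.IsStd)
    (f' : ℂ → HA L e dV hdV dW hdW → ℂ) (hstd' : IsStandardSectionFamily 𝒦₂ χ f') (hcont' : ∀ s, Continuous (f' s)) :
    ∃ Es : ℂ → HA L e dV hdV dW hdW → ℂ,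
      (∀ h : HA L e dV hdV dW hdW, DifferentiableOn ℂ (fun s => Es s h) {s : ℂ | 0 < s.re}) ∧
      (∀ s : ℂ, 0 < s.re → Continuous (Es s)) ∧
      (∀ s : ℂ, 0 < s.re → ∀ (γ : ratH L e dV hdV dW hdW) (h : HA L e dV hdV dW hdW), Es s ((γ : HA L e dV hdV dW hdW) * h) = Es s h) ∧
      (∀ (s : ℂ) (h : HA L e dV hdV dW hdW), (n : ℝ) / 2 < s.re →
        Es s h = (∏ q ∈ P, (s - q)) * eisensteinFamilyDelta L e dV hdV dW hdW f' s h) ∧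
      (∀ z : ℂ, 0 < z.re → ∃ C A r : ℝ, 0 < r ∧ ∀ s : ℂ, dist s z < r → ∀ h : HA L e dV hdV dW hdW,
        ‖Es s h‖ ≤ C * adelicHeightGL (n + n) L (h : GL (Fin (n + n)) (AdeleRing (𝓞 L) L)) ^ A) := by
  obtain ⟨p, 𝒦, hp, -, hK, harch⟩ := exists_isSiegelDelta_conjDatum_arch_iff L e dV hdV hdV0 dW hdW hdW0 h₁ h₂
  have h𝒦 : 𝒦.IsStd := isStd_of_conj h₂ p hK
  have hc : ∀ k : HA L e dV hdV dW hdW, k ∈ 𝒦.K ↔ p⁻¹ * k * p⁻¹⁻¹ ∈ 𝒦₂.K := fun k => by rw [inv_inv]; exact hK k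
  exact continuation_of_conjDatum_poleSet L e dV hdV dW hdW hn 𝒦 𝒦₂ p⁻¹ hc P (h41 𝒦 h𝒦 harch) f' hstd' hcont'

end Summit.HodgeConjecture.HodgeConjecture.Cruxes.HLiu418.K2LiuSiegelEisensteinArchClassTransportPoleSet

end
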